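import Literature.NumberTheory.Automorphic.QuaternionCoordOrderHeckeProofs
import Literature.NumberTheory.Automorphic.AdicCompletionUnitNorms
import HarnessLib

/-!
# Strong approximation modulo `v` for `O¹` from `v`-adic density (Hensel step)

Topic `NumberTheory/Automorphic`; second companion ("proofs") file of `QuaternionCoordOrder` for
its named fact `QuaternionAlgebra.coordOrder_heckeDoubleCoset`, on top of
`QuaternionCoordOrderHeckeProofs` (which proves the fact from the hypothesis
`SA_v : ∀ y ∈ O, y ȳ ≡ 1 (mod vO) → ∃ u ∈ O¹, u ≡ y (mod vO)`). All declarations here are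
theorems and one auxiliary definition (`toAdicCompletion`, the coordinatewise map
`ℍ[K,a,b] → ℍ[K_v,a,b]`); no named fact.

We derive `SA_v` from the **`v`-adic density of `O¹` in `O_v¹`** at level one,

  `(D_v)  ∀ y ∈ O_v = 𝒪_v⟨1,i,j,k⟩ ⊆ ℍ[K_v,a,b] with y ȳ = 1, ∃ u ∈ O¹, ι_v(u) ≡ y (mod 𝔪_v O_v)`,

which is the statement delivered at the place `v` by Kneser's strong approximation theorem
(Vignéras, LNM 800, Ch. III §4 Thm. 4.3: `H¹_K` is dense in `H¹_A / H¹_∞` when `ℍ[K,a,b]` is not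
totally definite) after the standard adelic bookkeeping (`O = ℍ[K,a,b] ∩ ∏_w O_w`); that theorem
is not yet in the tree. The step `D_v ⇒ SA_v` (`normOne_lift_of_adicCompletion_dense`) is the
Hensel argument of Vignéras II §1 Lemme 1.10 (`R₁* = R₁*²` at `v ∤ 2`): for `y ∈ O` with
`n(y) = y ȳ ≡ 1 (mod v)` the `v`-adic unit `n(y)` has an inverse square root `r ≡ 1 (mod 𝔪_v)`
in `𝒪_v` (`exists_sub_one_mem_and_sq_mul_eq_one`, from `exists_sq_eq_of_sq_sub_mem_maximalIdeal`
of `AdicCompletionUnitNorms`), so `y' = r y ∈ O_v¹` with `y' ≡ y`; a global `u ∈ O¹` with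
`u ≡ y' (mod 𝔪_v O_v)` then satisfies `u - y ∈ O ∩ 𝔪_v O_v = v O`. For the passage from an
adelic density statement to `D_v` we also record the local–global principle
`mem_coordOrder_iff_forall_toAdicCompletion_mem` (`O = {x : ι_w(x) ∈ O_w ∀ w}`, Vignéras III §5
Prop. 5.1) and its unit / norm-one companions. Consequently
(`coordOrder_heckeDoubleCoset_of_forall_adicCompletion_dense`) the named fact follows from
`D_v` at all places `v ∤ 2ab` of all non-totally-definite `ℍ[K,a,b]`.

## References

* M.-F. Vignéras, *Arithmétique des algèbres de quaternions*, LNM 800 (1980): Ch. II §1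
  Lemme 1.10; Ch. III §4 Thm. 4.3 (Kneser), §5 A [VignerasLNM800].
* G. Shimura, *Introduction to the arithmetic theory of automorphic functions* (1971), §3.1,
  Prop. 3.1 [Shimura1971].
-/

noncomputable section

open scoped Quaternion Pointwise
open NumberField IsDedekindDomain

namespace Literature.NumberTheory.Automorphic

namespace QuaternionAlgebra

/-- `ℍ⟮K; R; a, b⟯ := ℍ[K, algebraMap R K a, algebraMap R K b]` (file-local notation, as in
`QuaternionCoordOrder`). -/
local notation "ℍ⟮" K "; " R "; " a ", " b "⟯" =>
  QuaternionAlgebra K (algebraMap R K a) (0 : K) (algebraMap R K b)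

/-! ### Scalars and the ideal lattices -/

section Generic

variable {R : Type*} {K : Type*} [CommRing R] [CommRing K] [Algebra R K] {a b : R}

/-- `m x ∈ I O` for `m ∈ I` and `x ∈ O`. [folklore] -/
theorem smul_mem_idealLattice {I : Ideal R} {m : R} (hm : m ∈ I) {x : ℍ⟮K; R; a, b⟯}
    (hx : x ∈ coordOrder K a b) : m • x ∈ idealLattice K a b I := by
  obtain ⟨r₀, r₁, r₂, r₃, rfl⟩ := mem_coordOrder_iff_exists.mp hx
  rw [mem_idealLattice_iff_exists]
  exact ⟨m * r₀, I.mul_mem_right _ hm, m * r₁, I.mul_mem_right _ hm, m * r₂, I.mul_mem_right _ hm,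
    m * r₃, I.mul_mem_right _ hm, by ext <;> simp [Algebra.smul_def]⟩

/-- For a scalar `c ∈ R`: `c - 1 ∈ I O ↔ c - 1 ∈ I` (`R → K` injective). [folklore] -/
theorem algebraMap_sub_one_mem_idealLattice_iff [FaithfulSMul R K] {I : Ideal R} {c : R} :
    algebraMap K ℍ⟮K; R; a, b⟯ (algebraMap R K c) - 1 ∈ idealLattice K a b I ↔ c - 1 ∈ I := by
  have h : algebraMap K ℍ⟮K; R; a, b⟯ (algebraMap R K c) - 1 =
      ⟨algebraMap R K (c - 1), algebraMap R K 0, algebraMap R K 0, algebraMap R K 0⟩ := by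
    rw [_root_.QuaternionAlgebra.algebraMap_eq]
    ext <;> simp
  rw [h, mem_idealLattice_iff_exists]
  constructor
  · rintro ⟨r₀, hr₀, r₁, -, r₂, -, r₃, -, h⟩
    rw [_root_.QuaternionAlgebra.mk.injEq] at h
    rwa [FaithfulSMul.algebraMap_injective R K h.1]
  · intro hc
    exact ⟨c - 1, hc, 0, I.zero_mem, 0, I.zero_mem, 0, I.zero_mem, rfl⟩

end Generic

/-! ### Inverse square roots of principal units (Hensel) -/

section Hensel

/-- In a Henselian local ring `S` with `2 ∈ Sˣ`, every `c ≡ 1 (mod 𝔪)` has an inverse square root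
`r ≡ 1 (mod 𝔪)`: `r² c = 1` (Hensel's lemma for `X² - c⁻¹` at `1`, then the sign of `r` is fixed
by `(r - 1)(r + 1) = c⁻¹ - 1 ∈ 𝔪`; Vignéras II §1, proof of Lemme 1.10: `R₁* = R₁*²`).
[cite: VignerasLNM800, Ch. II §1 Lemme 1.10] -/
theorem exists_sub_one_mem_and_sq_mul_eq_one {S : Type*} [CommRing S] [HenselianLocalRing S]
    (h2 : IsUnit (2 : S)) {c : S} (hc : c - 1 ∈ IsLocalRing.maximalIdeal S) :
    ∃ r : S, r - 1 ∈ IsLocalRing.maximalIdeal S ∧ r ^ 2 * c = 1 := by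
  have hcu : IsUnit c := by
    by_contra h
    have h1 : (1 : S) ∈ IsLocalRing.maximalIdeal S := by
      have := sub_mem ((IsLocalRing.mem_maximalIdeal _).mpr h) hc
      rwa [sub_sub_cancel] at this
    exact (IsLocalRing.maximalIdeal.isMaximal S).ne_top
      ((Ideal.eq_top_iff_one _).mpr h1)
  obtain ⟨d, hd⟩ := hcu.exists_left_inv
  have hd1 : 1 ^ 2 - d ∈ IsLocalRing.maximalIdeal S := by
    have h : 1 ^ 2 - d = d * (c - 1) := by linear_combination -hd
    rw [h]
    exact Ideal.mul_mem_left _ d hc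
  obtain ⟨z, hz⟩ := exists_sq_eq_of_sq_sub_mem_maximalIdeal h2 isUnit_one hd1
  have hz1 : (z - 1) * (z + 1) ∈ IsLocalRing.maximalIdeal S := by
    have h : (z - 1) * (z + 1) = -(1 ^ 2 - d) := by linear_combination hz
    rw [h]
    exact neg_mem hd1
  rcases (IsLocalRing.maximalIdeal.isMaximal S).isPrime.mem_or_mem hz1 with h | h
  · exact ⟨z, h, by rw [hz, hd]⟩
  · refine ⟨-z, ?_, by rw [neg_sq, hz, hd]⟩
    have h' : -z - 1 = -(z + 1) := by ring
    rw [h']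
    exact neg_mem h

end Hensel

/-! ### The coordinate order at a finite place -/

section Local

variable {K : Type} [Field K] [NumberField K] (a b : 𝓞 K) (v : HeightOneSpectrum (𝓞 K))

/-- `K_v`. -/
local notation "Kᵥ" => HeightOneSpectrum.adicCompletion K v

/-- `𝒪_v`. -/
local notation "𝒪ᵥ" => HeightOneSpectrum.adicCompletionIntegers K v

/-- `a` as an element of `𝒪_v`. -/
local notation "aᵥ" => algebraMap (𝓞 K) (HeightOneSpectrum.adicCompletionIntegers K v) a

/-- `b` as an element of `𝒪_v`. -/
local notation "bᵥ" => algebraMap (𝓞 K) (HeightOneSpectrum.adicCompletionIntegers K v) b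

/-- The **coordinatewise map `ι_v : ℍ[K,a,b] →ₐ[K] ℍ[K_v,a,b]`** into the quaternion algebra over
the completion, whose coordinate order `𝒪_v⟨1,i,j,k⟩` (`coordOrder Kᵥ aᵥ bᵥ`) is the local order
`O_v` (the integral model `intModelHom` over `K → K_v`; Vignéras III §5 A, `O_v = R_v[e]`).
[cite: VignerasLNM800, Ch. III §5 A] -/
def toAdicCompletion : ℍ⟮K; 𝓞 K; a, b⟯ →ₐ[K] ℍ⟮Kᵥ; 𝒪ᵥ; aᵥ, bᵥ⟯ :=
  intModelHom (HeightOneSpectrum.adicCompletion K v) (algebraMap (𝓞 K) K a)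
    (algebraMap (𝓞 K) K b)

/-- `ι_v` in coordinates. [folklore] -/
theorem toAdicCompletion_apply (x : ℍ⟮K; 𝓞 K; a, b⟯) :
    toAdicCompletion a b v x = ⟨algebraMap K Kᵥ x.re, algebraMap K Kᵥ x.imI,
      algebraMap K Kᵥ x.imJ, algebraMap K Kᵥ x.imK⟩ :=
  intModelHom_apply _ _ _ x

/-- `ι_v(x̄) = ι_v(x)‾`. [folklore] -/
theorem toAdicCompletion_star (x : ℍ⟮K; 𝓞 K; a, b⟯) :
    toAdicCompletion a b v (star x) = star (toAdicCompletion a b v x) :=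
  intModelHom_star _ _ _ x

/-- `ι_v(r₀ + r₁ i + r₂ j + r₃ k)` has coordinates the images of the `rᵢ ∈ 𝓞 K` in `𝒪_v`.
[folklore] -/
theorem toAdicCompletion_mk (r₀ r₁ r₂ r₃ : 𝓞 K) :
    toAdicCompletion a b v ⟨algebraMap (𝓞 K) K r₀, algebraMap (𝓞 K) K r₁, algebraMap (𝓞 K) K r₂,
        algebraMap (𝓞 K) K r₃⟩ =
      ⟨algebraMap 𝒪ᵥ Kᵥ (algebraMap (𝓞 K) 𝒪ᵥ r₀), algebraMap 𝒪ᵥ Kᵥ (algebraMap (𝓞 K) 𝒪ᵥ r₁),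
        algebraMap 𝒪ᵥ Kᵥ (algebraMap (𝓞 K) 𝒪ᵥ r₂), algebraMap 𝒪ᵥ Kᵥ (algebraMap (𝓞 K) 𝒪ᵥ r₃)⟩ := by
  rw [toAdicCompletion_apply]
  rfl

/-- `ι_v(O) ⊆ O_v`. [cite: VignerasLNM800, Ch. III §5 A] -/
theorem toAdicCompletion_mem {x : ℍ⟮K; 𝓞 K; a, b⟯} (hx : x ∈ coordOrder K a b) :
    toAdicCompletion a b v x ∈ coordOrder Kᵥ aᵥ bᵥ := by
  obtain ⟨r₀, r₁, r₂, r₃, rfl⟩ := mem_coordOrder_iff_exists.mp hx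
  rw [toAdicCompletion_mk]
  exact mk_mem_coordOrder Kᵥ aᵥ bᵥ _ _ _ _

/-- The valuation of a global element in the completion. [folklore] -/
theorem valued_algebraMap_adicCompletion (k : K) :
    Valued.v (algebraMap K Kᵥ k) = v.valuation K k :=
  HeightOneSpectrum.valuedAdicCompletion_eq_valuation' v k

/-- `x ∈ 𝔪_v ↔ v(x) < 1` for `x ∈ 𝒪_v`. [folklore] -/
theorem mem_maximalIdeal_adicCompletionIntegers_iff {x : 𝒪ᵥ} :
    x ∈ IsLocalRing.maximalIdeal 𝒪ᵥ ↔ Valued.v (x : Kᵥ) < 1 := by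
  rw [IsLocalRing.mem_maximalIdeal, mem_nonunits_iff,
    HeightOneSpectrum.adicCompletionIntegers.isUnit_iff_valued_eq_one]
  exact ⟨fun h => lt_of_le_of_ne x.2 h, fun h => h.ne⟩

/-- A global integer lies in `𝔪_v` iff it lies in `v`. [folklore] -/
theorem algebraMap_mem_maximalIdeal_iff (r : 𝓞 K) :
    algebraMap (𝓞 K) 𝒪ᵥ r ∈ IsLocalRing.maximalIdeal 𝒪ᵥ ↔ r ∈ v.asIdeal := by
  rw [mem_maximalIdeal_adicCompletionIntegers_iff]
  change Valued.v (algebraMap K Kᵥ (algebraMap (𝓞 K) K r)) < 1 ↔ _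
  rw [valued_algebraMap_adicCompletion, HeightOneSpectrum.valuation_lt_one_iff_mem]

/-- `2 ∈ 𝒪_vˣ` for `v ∤ 2`. [folklore] -/
theorem isUnit_two_adicCompletionIntegers (h2 : (2 : 𝓞 K) ∉ v.asIdeal) : IsUnit (2 : 𝒪ᵥ) := by
  rw [← map_ofNat (algebraMap (𝓞 K) 𝒪ᵥ) 2,
    HeightOneSpectrum.adicCompletionIntegers.isUnit_iff_valued_eq_one]
  change Valued.v (algebraMap K Kᵥ (algebraMap (𝓞 K) K 2)) = 1
  rw [valued_algebraMap_adicCompletion, HeightOneSpectrum.valuation_eq_one_iff_notMem]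
  exact h2

/-- For `d ∈ O`: `ι_v(d) ∈ 𝔪_v O_v ↔ d ∈ v O` (a global integer is in `𝔪_v` iff it is in `v`,
coordinate by coordinate; `O ∩ 𝔪_v O_v = v O`). [cite: VignerasLNM800, Ch. III §5 A (Prop. 5.1, local–global for lattices)] -/
theorem toAdicCompletion_mem_idealLattice_maximalIdeal_iff {d : ℍ⟮K; 𝓞 K; a, b⟯}
    (hd : d ∈ coordOrder K a b) :
    toAdicCompletion a b v d ∈ idealLattice Kᵥ aᵥ bᵥ (IsLocalRing.maximalIdeal 𝒪ᵥ) ↔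
      d ∈ idealLattice K a b v.asIdeal := by
  obtain ⟨r₀, r₁, r₂, r₃, rfl⟩ := mem_coordOrder_iff_exists.mp hd
  rw [toAdicCompletion_mk, mem_idealLattice_iff_exists, mem_idealLattice_iff_exists]
  constructor
  · rintro ⟨e₀, he₀, e₁, he₁, e₂, he₂, e₃, he₃, h⟩
    rw [_root_.QuaternionAlgebra.mk.injEq] at h
    have hinj := FaithfulSMul.algebraMap_injective 𝒪ᵥ Kᵥ
    refine ⟨r₀, ?_, r₁, ?_, r₂, ?_, r₃, ?_, rfl⟩
    · rw [← algebraMap_mem_maximalIdeal_iff, hinj h.1]; exact he₀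
    · rw [← algebraMap_mem_maximalIdeal_iff, hinj h.2.1]; exact he₁
    · rw [← algebraMap_mem_maximalIdeal_iff, hinj h.2.2.1]; exact he₂
    · rw [← algebraMap_mem_maximalIdeal_iff, hinj h.2.2.2]; exact he₃
  · rintro ⟨s₀, hs₀, s₁, hs₁, s₂, hs₂, s₃, hs₃, h⟩
    rw [_root_.QuaternionAlgebra.mk.injEq] at h
    have hinj := FaithfulSMul.algebraMap_injective (𝓞 K) K
    obtain ⟨rfl, rfl, rfl, rfl⟩ : r₀ = s₀ ∧ r₁ = s₁ ∧ r₂ = s₂ ∧ r₃ = s₃ :=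
      ⟨hinj h.1, hinj h.2.1, hinj h.2.2.1, hinj h.2.2.2⟩
    exact ⟨_, (algebraMap_mem_maximalIdeal_iff v r₀).mpr hs₀,
      _, (algebraMap_mem_maximalIdeal_iff v r₁).mpr hs₁,
      _, (algebraMap_mem_maximalIdeal_iff v r₂).mpr hs₂,
      _, (algebraMap_mem_maximalIdeal_iff v r₃).mpr hs₃, rfl⟩

/-- `ι_v` carries `y ȳ = c` (`c ∈ 𝓞 K`) to `ι_v(y) ι_v(y)‾ = c` with `c` seen in `𝒪_v`. [folklore] -/
theorem toAdicCompletion_mul_star {y : ℍ⟮K; 𝓞 K; a, b⟯} {c : 𝓞 K}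
    (hyy : y * star y = algebraMap K ℍ⟮K; 𝓞 K; a, b⟯ (algebraMap (𝓞 K) K c)) :
    toAdicCompletion a b v y * star (toAdicCompletion a b v y) =
      algebraMap 𝒪ᵥ ℍ⟮Kᵥ; 𝒪ᵥ; aᵥ, bᵥ⟯ (algebraMap (𝓞 K) 𝒪ᵥ c) := by
  rw [← toAdicCompletion_star, ← map_mul, hyy, AlgHom.commutes,
    IsScalarTower.algebraMap_apply K Kᵥ ℍ⟮Kᵥ; 𝒪ᵥ; aᵥ, bᵥ⟯,
    IsScalarTower.algebraMap_apply 𝒪ᵥ Kᵥ ℍ⟮Kᵥ; 𝒪ᵥ; aᵥ, bᵥ⟯]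
  rfl

/-- **Strong approximation modulo `v` for `O¹` from `v`-adic density** (the Hensel step,
Vignéras II §1 Lemme 1.10, `R₁* = R₁*²`). If every `y ∈ O_v = 𝒪_v⟨1,i,j,k⟩` with `y ȳ = 1` is
congruent modulo `𝔪_v O_v` to (the image of) an element of `O¹` — the level-one consequence at
`v` of Kneser's strong approximation theorem (Vignéras III Thm. 4.3) — then every `y ∈ O` with
`y ȳ ≡ 1 (mod vO)` is congruent modulo `vO` to an element of `O¹` (`v ∤ 2`): the `v`-adic unit
`n(y)` has an inverse square root `r ≡ 1 (mod 𝔪_v)`, `y' = r y ∈ O_v¹`, `y' ≡ y`, and a global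
`u ≡ y' (mod 𝔪_v O_v)` in `O¹` has `u - y ∈ O ∩ 𝔪_v O_v = v O`.
[cite: VignerasLNM800, Ch. II §1 Lemme 1.10 and Ch. III §4 Thm. 4.3] -/
theorem normOne_lift_of_adicCompletion_dense (h2 : (2 : 𝓞 K) ∉ v.asIdeal)
    (hD : ∀ y ∈ coordOrder Kᵥ aᵥ bᵥ, y * star y = 1 →
      ∃ u ∈ normOneGroup K a b,
        toAdicCompletion a b v (u : ℍ⟮K; 𝓞 K; a, b⟯) - y ∈
          idealLattice Kᵥ aᵥ bᵥ (IsLocalRing.maximalIdeal 𝒪ᵥ)) :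
    ∀ y ∈ coordOrder K a b, y * star y - 1 ∈ idealLattice K a b v.asIdeal →
      ∃ u ∈ normOneGroup K a b, (u : ℍ⟮K; 𝓞 K; a, b⟯) - y ∈ idealLattice K a b v.asIdeal := by
  intro y hy hy1
  obtain ⟨c₀, hc₀⟩ := exists_mul_star_eq_algebraMap (K := K) hy
  have hc₁ : c₀ - 1 ∈ v.asIdeal := by
    rwa [hc₀, algebraMap_sub_one_mem_idealLattice_iff] at hy1
  -- the `v`-adic unit `c = n(y)` and its inverse square root `r ≡ 1`
  have hc : algebraMap (𝓞 K) 𝒪ᵥ c₀ - 1 ∈ IsLocalRing.maximalIdeal 𝒪ᵥ := by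
    rw [← map_one (algebraMap (𝓞 K) 𝒪ᵥ), ← map_sub, algebraMap_mem_maximalIdeal_iff]
    exact hc₁
  obtain ⟨r, hr1, hrc⟩ :=
    exists_sub_one_mem_and_sq_mul_eq_one (isUnit_two_adicCompletionIntegers v h2) hc
  -- `y' = r ι(y) ∈ O_v¹`, `y' ≡ ι(y)`
  have hιy : toAdicCompletion a b v y ∈ coordOrder Kᵥ aᵥ bᵥ := toAdicCompletion_mem a b v hy
  have hy'O : r • toAdicCompletion a b v y ∈ coordOrder Kᵥ aᵥ bᵥ := Subalgebra.smul_mem _ hιy r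
  have hy'1 : (r • toAdicCompletion a b v y) * star (r • toAdicCompletion a b v y) = 1 := by
    rw [_root_.QuaternionAlgebra.star_smul, smul_mul_smul_comm, toAdicCompletion_mul_star a b v hc₀,
      Algebra.smul_def, ← map_mul, ← pow_two, hrc, map_one]
  have hy'y : r • toAdicCompletion a b v y - toAdicCompletion a b v y ∈
      idealLattice Kᵥ aᵥ bᵥ (IsLocalRing.maximalIdeal 𝒪ᵥ) := by
    have h : r • toAdicCompletion a b v y - toAdicCompletion a b v y =
        (r - 1) • toAdicCompletion a b v y := by
      rw [sub_smul, one_smul]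
    rw [h]
    exact smul_mem_idealLattice hr1 hιy
  -- density: a global `u ∈ O¹` with `ι(u) ≡ y'`
  obtain ⟨u, hu, huy⟩ := hD _ hy'O hy'1
  refine ⟨u, hu, ?_⟩
  have hdiff : toAdicCompletion a b v ((u : ℍ⟮K; 𝓞 K; a, b⟯) - y) ∈
      idealLattice Kᵥ aᵥ bᵥ (IsLocalRing.maximalIdeal 𝒪ᵥ) := by
    have h : toAdicCompletion a b v ((u : ℍ⟮K; 𝓞 K; a, b⟯) - y) =
        (toAdicCompletion a b v (u : ℍ⟮K; 𝓞 K; a, b⟯) - r • toAdicCompletion a b v y) +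
          (r • toAdicCompletion a b v y - toAdicCompletion a b v y) := by
      rw [map_sub, sub_add_sub_cancel]
    rw [h]
    exact add_mem huy hy'y
  exact (toAdicCompletion_mem_idealLattice_maximalIdeal_iff a b v
    (sub_mem (normOneGroup_le_unitGroup K a b hu).1 hy)).mp hdiff

/-! #### Local–global for the coordinate order -/

/-- `ι_v` is injective. [folklore] -/
theorem toAdicCompletion_injective : Function.Injective (toAdicCompletion a b v) :=
  intModelHom_injective _ _ _

/-- A coordinate lies in `𝒪_v` iff its valuation is `≤ 1`. [folklore] -/
theorem algebraMap_mem_range_adicCompletionIntegers_iff (k : K) :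
    algebraMap K Kᵥ k ∈ Set.range (algebraMap 𝒪ᵥ Kᵥ) ↔ v.valuation K k ≤ 1 := by
  rw [← valued_algebraMap_adicCompletion v k]
  constructor
  · rintro ⟨o, ho⟩
    rw [← ho]
    exact o.2
  · intro h
    exact ⟨⟨algebraMap K Kᵥ k, h⟩, rfl⟩

/-- `ι_v(x) ∈ O_v` iff the four coordinates of `x` have `v`-valuation `≤ 1`. [folklore] -/
theorem toAdicCompletion_mem_iff (x : ℍ⟮K; 𝓞 K; a, b⟯) :
    toAdicCompletion a b v x ∈ coordOrder Kᵥ aᵥ bᵥ ↔ v.valuation K x.re ≤ 1 ∧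
      v.valuation K x.imI ≤ 1 ∧ v.valuation K x.imJ ≤ 1 ∧ v.valuation K x.imK ≤ 1 := by
  rw [mem_coordOrder_iff', toAdicCompletion_apply]
  simp only [algebraMap_mem_range_adicCompletionIntegers_iff]

end Local

section LocalGlobal

variable {K : Type} [Field K] [NumberField K] (a b : 𝓞 K)

/-- **Local–global principle for the coordinate order**: `x ∈ O ↔ ι_w(x) ∈ O_w` for every finite
place `w` (an element of `K` is integral iff it is integral at every finite place, Mathlib
`HeightOneSpectrum.mem_integers_of_valuation_le_one`; Vignéras III §5 A, Prop. 5.1: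
`X = {x ∈ V : x_v ∈ X_v ∀ v}` for a lattice `X`). [cite: VignerasLNM800, Ch. III §5 Prop. 5.1] -/
theorem mem_coordOrder_iff_forall_toAdicCompletion_mem (x : ℍ⟮K; 𝓞 K; a, b⟯) :
    x ∈ coordOrder K a b ↔ ∀ w : HeightOneSpectrum (𝓞 K),
      toAdicCompletion a b w x ∈ coordOrder (w.adicCompletion K)
        (algebraMap (𝓞 K) (w.adicCompletionIntegers K) a)
        (algebraMap (𝓞 K) (w.adicCompletionIntegers K) b) := by
  constructor
  · intro hx w
    exact toAdicCompletion_mem a b w hx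
  · intro h
    simp only [toAdicCompletion_mem_iff] at h
    rw [mem_coordOrder_iff']
    exact ⟨HeightOneSpectrum.mem_integers_of_valuation_le_one K x.re fun w => (h w).1,
      HeightOneSpectrum.mem_integers_of_valuation_le_one K x.imI fun w => (h w).2.1,
      HeightOneSpectrum.mem_integers_of_valuation_le_one K x.imJ fun w => (h w).2.2.1,
      HeightOneSpectrum.mem_integers_of_valuation_le_one K x.imK fun w => (h w).2.2.2⟩

/-- The same for units: `u ∈ O^× ↔ ι_w(u), ι_w(u⁻¹) ∈ O_w` for all `w` (`O^× = ℍ^× ∩ ∏_w O_w^×`).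
[cite: VignerasLNM800, Ch. III §5 Prop. 5.1] -/
theorem mem_unitGroup_iff_forall_toAdicCompletion_mem (u : (ℍ⟮K; 𝓞 K; a, b⟯)ˣ) :
    u ∈ unitGroup K a b ↔ ∀ w : HeightOneSpectrum (𝓞 K),
      toAdicCompletion a b w (u : ℍ⟮K; 𝓞 K; a, b⟯) ∈ coordOrder (w.adicCompletion K)
          (algebraMap (𝓞 K) (w.adicCompletionIntegers K) a)
          (algebraMap (𝓞 K) (w.adicCompletionIntegers K) b) ∧
        toAdicCompletion a b w ((u⁻¹ : (ℍ⟮K; 𝓞 K; a, b⟯)ˣ) : ℍ⟮K; 𝓞 K; a, b⟯) ∈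
          coordOrder (w.adicCompletion K) (algebraMap (𝓞 K) (w.adicCompletionIntegers K) a)
            (algebraMap (𝓞 K) (w.adicCompletionIntegers K) b) := by
  rw [mem_unitGroup_iff, mem_coordOrder_iff_forall_toAdicCompletion_mem,
    mem_coordOrder_iff_forall_toAdicCompletion_mem, ← forall_and]

/-- Norm one is detected in the completion: `x x̄ = 1 ↔ ι_w(x) ι_w(x)‾ = 1` (`ι_w` is an injective
algebra map commuting with conjugation). [folklore] -/
theorem mul_star_eq_one_iff_toAdicCompletion (w : HeightOneSpectrum (𝓞 K)) (x : ℍ⟮K; 𝓞 K; a, b⟯) :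
    x * star x = 1 ↔ toAdicCompletion a b w x * star (toAdicCompletion a b w x) = 1 := by
  rw [← toAdicCompletion_star, ← map_mul, ← map_one (toAdicCompletion a b w),
    (toAdicCompletion_injective a b w).eq_iff]

end LocalGlobal

/-! ### The named fact from `v`-adic density -/

section NumberField

variable {K : Type} [Field K] [NumberField K]

/-- **`coordOrder_heckeDoubleCoset` at a place `v` from the `v`-adic density of `O¹` in `O_v¹`**
(level one): the Hensel step `normOne_lift_of_adicCompletion_dense` followed by the reduction
`coordOrder_heckeDoubleCoset_of_normOne_lift` of `QuaternionCoordOrderHeckeProofs`.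
[cite: VignerasLNM800, Ch. II §2 Thm. 2.3, Ch. III §4 Thm. 4.3] [cite: Shimura1971, Prop. 3.1] -/
theorem coordOrder_heckeDoubleCoset_of_adicCompletion_dense (a b : 𝓞 K)
    (v : HeightOneSpectrum (𝓞 K)) (ϖ : 𝓞 K) (g : (ℍ⟮K; 𝓞 K; a, b⟯)ˣ)
    (hv : v.asIdeal = Ideal.span {ϖ}) (h2ab : (2 * a * b : 𝓞 K) ∉ v.asIdeal)
    (hg : (g : ℍ⟮K; 𝓞 K; a, b⟯) ∈ coordOrder K a b)
    (hgg : (g : ℍ⟮K; 𝓞 K; a, b⟯) * star (g : ℍ⟮K; 𝓞 K; a, b⟯) =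
      algebraMap K ℍ⟮K; 𝓞 K; a, b⟯ (ϖ : K))
    (hD : ∀ y ∈ coordOrder (v.adicCompletion K) (algebraMap (𝓞 K) (v.adicCompletionIntegers K) a)
        (algebraMap (𝓞 K) (v.adicCompletionIntegers K) b), y * star y = 1 →
      ∃ u ∈ normOneGroup K a b, toAdicCompletion a b v (u : ℍ⟮K; 𝓞 K; a, b⟯) - y ∈
        idealLattice (v.adicCompletion K) (algebraMap (𝓞 K) (v.adicCompletionIntegers K) a)
          (algebraMap (𝓞 K) (v.adicCompletionIntegers K) b)
          (IsLocalRing.maximalIdeal (v.adicCompletionIntegers K))) :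
    DoubleCoset.doubleCoset g
        (unitGroup K a b : Set (ℍ⟮K; 𝓞 K; a, b⟯)ˣ)
        (unitGroup K a b : Set (ℍ⟮K; 𝓞 K; a, b⟯)ˣ) =
        {x : (ℍ⟮K; 𝓞 K; a, b⟯)ˣ |
          (x : ℍ⟮K; 𝓞 K; a, b⟯) ∈ coordOrder K a b ∧
          ∃ ε : (𝓞 K)ˣ, (x : ℍ⟮K; 𝓞 K; a, b⟯) *
            star (x : ℍ⟮K; 𝓞 K; a, b⟯) =
            algebraMap K ℍ⟮K; 𝓞 K; a, b⟯ (((ε : 𝓞 K) * ϖ : 𝓞 K) : K)} ∧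
      (MulAut.conj g⁻¹ • unitGroup K a b).relIndex (unitGroup K a b) = v.residueCard + 1 :=
  coordOrder_heckeDoubleCoset_of_normOne_lift a b v ϖ g hv h2ab hg hgg
    (normOne_lift_of_adicCompletion_dense a b v
      (fun h => h2ab (by simpa only [mul_assoc] using v.asIdeal.mul_mem_right (a * b) h)) hD)

/-- **`coordOrder_heckeDoubleCoset` follows from the `v`-adic density of `O¹` in `O_v¹` at every
`v ∤ 2ab`** for the coordinate orders of the non-totally-definite `ℍ[K,a,b]` — the consequence at
`v` of Kneser's strong approximation theorem (Vignéras III Thm. 4.3), which is thereby isolated as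
the only missing input of the named fact. [cite: VignerasLNM800, Ch. III §4 Thm. 4.3] [cite: Shimura1971, Prop. 3.1] -/
theorem coordOrder_heckeDoubleCoset_of_forall_adicCompletion_dense
    (H : ∀ (K : Type) [Field K] [NumberField K] (a b : 𝓞 K), a ≠ 0 → b ≠ 0 →
      ¬ IsTotallyDefinite K ℍ⟮K; 𝓞 K; a, b⟯ →
      ∀ v : HeightOneSpectrum (𝓞 K), (2 * a * b : 𝓞 K) ∉ v.asIdeal →
        ∀ y ∈ coordOrder (v.adicCompletion K) (algebraMap (𝓞 K) (v.adicCompletionIntegers K) a)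
            (algebraMap (𝓞 K) (v.adicCompletionIntegers K) b), y * star y = 1 →
          ∃ u ∈ normOneGroup K a b, toAdicCompletion a b v (u : ℍ⟮K; 𝓞 K; a, b⟯) - y ∈
            idealLattice (v.adicCompletion K) (algebraMap (𝓞 K) (v.adicCompletionIntegers K) a)
              (algebraMap (𝓞 K) (v.adicCompletionIntegers K) b)
              (IsLocalRing.maximalIdeal (v.adicCompletionIntegers K))) :
    coordOrder_heckeDoubleCoset := by
  intro K _ _ a b ha hb hdef v ϖ g hv h2ab hg hgg
  exact coordOrder_heckeDoubleCoset_of_adicCompletion_dense a b v ϖ g hv h2ab hg hgg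
    (H K a b ha hb hdef v h2ab)

end NumberField

end QuaternionAlgebra

end Literature.NumberTheory.Automorphic
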